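import Literature.Probability.LatticeModels.TriMeshTriangles
import Literature.Probability.LatticeModels.MeshCells
import Literature.Probability.LatticeModels.MeshLoops
import Literature.Probability.LatticeModels.MeshStrayParity
import HarnessLib

/-!
# Full and perfect triangles of the sheared triangular mesh of a planar domain

Topic: Probability / LatticeModels (second file of the triangular twin `TriMesh*` of the series
"the largest mesh component of a Jordan domain is the bulk"; sub-namespace
`Literature.Probability.LatticeModels.TriMesh`). Everything is in lattice coordinates
(`TriMeshTriangles.lean`): `Ω` is the embedded domain, `Ω' = triLinear ⁻¹' Ω` its shear preimage,
mesh points are `meshPoint δ`, the graph is H21's `triMeshGraph Ω δ` / `triMeshVertexGraph Ω δ`.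

* `IsFull Ω δ k n` — the open triangle `n` of column `k` lies in `Ω'`; then its closure lies in
  `Ω̄'`, and any two distinct corners are joined in the triangular mesh graph
  (`IsFull.triMeshGraph_adj`).
* `IsPerfect Ω δ k n` — full, and its corners are mesh vertices; the corners of a perfect
  triangle, and of a run of consecutive perfect triangles of one column, are mutually reachable in
  the mesh graph on mesh vertices (`reachable_of_isPerfect`, `reachable_of_perfect_run`) — the
  "ladder".
* Exterior points (using `∂Ω' ⊆ closure (Ω̄')ᶜ`, true for Jordan domains): a triangle that is not
  full contains an exterior point; a full imperfect triangle has a corner on `∂Ω'`; next to a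
  lattice point of the closure of the exterior there is an exterior point inside one of the six
  open triangles at that point (`exists_exterior_ktri_near`).
* Book-keeping for the counting argument: the ball of radius `δ/8` about the centre lies in the
  triangle, distinct triangles are disjoint, far triangles are not full, and a full triangle with
  a corner close to `Ω'ᶜ` lies in the inner collar.


This file also builds (second part, formerly planned as `TriMeshTriLoops.lean`) the pieces of the
short loops that cross a run of perfect triangles of one column and close up through the exterior:

* `AvoidsMesh Ω δ z` — `z` is not the (square) mesh point of a triangular mesh vertex and lies on
  no closed mesh edge between mesh vertices; points of open triangles, mesh points of
  non-vertices, and exterior points avoid the mesh.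
* **Access paths** (`exists_accessPath`): from the centre of a triangle that is *not perfect*
  there is a path to an exterior point, within `4δ`, all of whose points avoid the mesh.
* **The spine**: the vertical segment on the midline `re = δ(k + ½)` from the centre of triangle
  `b` to the centre of triangle `t`; it crosses the crossing edge `n`, `b < n ≤ t`, at its
  midpoint `(δ(k + ½), δn/2)`, transversally, with crossing defect `2πi`
  (`crossInc_spine_kcross`); a spine point on a closed `𝕋`-edge lies on such a crossing edge
  (`exists_eq_kcross_of_mem_segment`).

Folklore lattice geometry. Mathlib anchors: `Convex.openSegment_interior_closure_subset_interior`,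
`Metric.infDist`, `SimpleGraph.induce`, `Path.segment`, `Path.trans`; `Path.crossInc`,
`crossInc_segment_of_cross`, `segSide` (`ArgumentIncrement.lean`). H21 anchors: `TriMesh.ktri`, `TriMesh.IsCorner`,
`TriMesh.kcenter`, `triMeshGraph_adj_iff_shear` (`TriMeshTriangles.lean`),
`Mesh.exists_mem_exterior_of_isOpen`, `Mesh.abs_moveAway`, `Mesh.exists_mem_Ioo_of_abs_lt`
(`MeshCells.lean`).
-/

namespace Literature.Probability.LatticeModels.TriMesh

open Set Complex Metric

noncomputable section

variable {Ω : Set ℂ} {δ : ℝ} {k n : ℤ}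

/-! ### Full triangles -/

/-- The triangle `n` of column `k` is *full* if the open triangle lies in the sheared domain
`Ω' = triLinear ⁻¹' Ω`. [folklore] -/
def IsFull (Ω : Set ℂ) (δ : ℝ) (k n : ℤ) : Prop := ktri δ k n ⊆ triLinear ⁻¹' Ω

/-- The triangle is *perfect* if it is full and its corners are mesh vertices. [folklore] -/
def IsPerfect (Ω : Set ℂ) (δ : ℝ) (k n : ℤ) : Prop :=
  IsFull Ω δ k n ∧ ∀ v, IsCorner k n v → v ∈ triMeshVertices Ω δ

/-- The closure of a full triangle lies in `Ω̄'`. [folklore] -/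
theorem IsFull.closure_subset (h : IsFull Ω δ k n) : closure (ktri δ k n) ⊆ closure (triLinear ⁻¹' Ω) :=
  closure_mono h

/-- A full triangle's closure misses the exterior `(Ω̄')ᶜ`. [folklore] -/
theorem IsFull.disjoint_closure_exterior (h : IsFull Ω δ k n) :
    Disjoint (closure (ktri δ k n)) (closure (triLinear ⁻¹' Ω))ᶜ :=
  disjoint_compl_right.mono_left h.closure_subset

/-- In a full triangle, a closed segment between two corners lies in `Ω̄'`. [folklore] -/
theorem IsFull.segment_subset (hδ : 0 < δ) (h : IsFull Ω δ k n) {v w : Site 2} (hv : IsCorner k n v)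
    (hw : IsCorner k n w) : segment ℝ (meshPoint δ v) (meshPoint δ w) ⊆ closure (triLinear ⁻¹' Ω) :=
  (segment_subset_closure_ktri hδ hv hw).trans h.closure_subset

/-- **In a full triangle, distinct corners are joined in the triangular mesh graph.** [folklore] -/
theorem IsFull.triMeshGraph_adj (hδ : 0 < δ) (h : IsFull Ω δ k n) {v w : Site 2} (hv : IsCorner k n v)
    (hw : IsCorner k n w) (hne : v ≠ w) : (triMeshGraph Ω δ).Adj v w :=
  triMeshGraph_adj_iff_shear.2 ⟨triGraph_adj_of_isCorner hv hw hne, h.segment_subset hδ hv hw⟩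

/-! ### Perfect triangles and ladders -/

/-- Adjacency in the mesh graph on mesh vertices is adjacency in the mesh graph. [folklore] -/
theorem triMeshVertexGraph_adj_iff {x y : Site 2} (hx : x ∈ triMeshVertices Ω δ)
    (hy : y ∈ triMeshVertices Ω δ) :
    (triMeshVertexGraph Ω δ).Adj ⟨x, hx⟩ ⟨y, hy⟩ ↔ (triMeshGraph Ω δ).Adj x y :=
  Iff.rfl

/-- In a perfect triangle any two corners are reachable from each other in the mesh graph on mesh
vertices. [folklore] -/
theorem reachable_of_isPerfect (hδ : 0 < δ) (h : IsPerfect Ω δ k n) {v w : Site 2}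
    (hv : IsCorner k n v) (hw : IsCorner k n w) :
    (triMeshVertexGraph Ω δ).Reachable ⟨v, h.2 v hv⟩ ⟨w, h.2 w hw⟩ := by
  by_cases hne : v = w
  · subst hne; rfl
  · exact SimpleGraph.Adj.reachable ((triMeshVertexGraph_adj_iff _ _).2
      (h.1.triMeshGraph_adj hδ hv hw hne))

/-- The left end of the edge `n` is a corner of the triangle `n`. [folklore] -/
theorem isCorner_xL (k n : ℤ) : IsCorner k n (xL k n) := Or.inl rfl

/-- The right end of the edge `n` is a corner of the triangle `n`. [folklore] -/
theorem isCorner_xR (k n : ℤ) : IsCorner k n (xR k n) := Or.inr (Or.inl rfl)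

/-- The left end of the edge `n + 1` is a corner of the triangle `n`. [folklore] -/
theorem isCorner_xL_succ (k n : ℤ) : IsCorner k n (xL k (n + 1)) := Or.inr (Or.inr (Or.inl rfl))

/-- The right end of the edge `n + 1` is a corner of the triangle `n`. [folklore] -/
theorem isCorner_xR_succ (k n : ℤ) : IsCorner k n (xR k (n + 1)) := Or.inr (Or.inr (Or.inr rfl))

/-- **Ladder.** In a run of consecutive perfect triangles `n₁, n₁ + 1, …, n₁ + m` of column `k`,
every corner of every triangle of the run is reachable from the left end of the edge `n₁`.
[folklore] -/
theorem reachable_of_perfect_run (hδ : 0 < δ) {k n₁ : ℤ} {m : ℕ}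
    (h : ∀ i : ℕ, i ≤ m → IsPerfect Ω δ k (n₁ + i)) {i : ℕ} (hi : i ≤ m) {v : Site 2}
    (hv : IsCorner k (n₁ + i) v) :
    (triMeshVertexGraph Ω δ).Reachable
      ⟨xL k n₁, by simpa using (h 0 (Nat.zero_le _)).2 _ (isCorner_xL k (n₁ + (0 : ℕ)))⟩
      ⟨v, (h i hi).2 v hv⟩ := by
  induction i generalizing v with
  | zero =>
    have := reachable_of_isPerfect hδ (h 0 (Nat.zero_le _)) (isCorner_xL k _) hv
    simpa using this
  | succ i ih =>
    have hi' : i ≤ m := (Nat.le_succ i).trans hi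
    -- climb to the left end of the edge `n₁ + i + 1`, a corner of both triangles
    have heq : n₁ + ((i + 1 : ℕ) : ℤ) = n₁ + (i : ℕ) + 1 := by push_cast; ring
    have hc1 : IsCorner k (n₁ + i) (xL k (n₁ + ((i + 1 : ℕ) : ℤ))) := by
      rw [heq]; exact isCorner_xL_succ k _
    have h1 := ih hi' hc1
    have h2 := reachable_of_isPerfect hδ (h (i + 1) hi) (isCorner_xL k _) hv
    exact h1.trans h2

/-! ### Exterior points in and near triangles -/

/-- **A triangle that is not full contains an exterior point** (for open `Ω'` with
`∂Ω' ⊆ closure (Ω̄')ᶜ`). [folklore] -/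
theorem exists_mem_ktri_exterior_of_not_isFull (hΩo : IsOpen (triLinear ⁻¹' Ω))
    (hJE : frontier (triLinear ⁻¹' Ω) ⊆ closure (closure (triLinear ⁻¹' Ω))ᶜ) {k n : ℤ}
    (h : ¬ IsFull Ω δ k n) : ∃ x ∈ ktri δ k n, x ∈ (closure (triLinear ⁻¹' Ω))ᶜ := by
  obtain ⟨z, hz, hzΩ⟩ := not_subset.1 h
  exact Mesh.exists_mem_exterior_of_isOpen hΩo hJE (isOpen_ktri δ k n) hz hzΩ

/-- A full triangle that is not perfect has a corner off `Ω'`, which is then a frontier point.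
[folklore] -/
theorem exists_corner_mem_frontier (hΩo : IsOpen (triLinear ⁻¹' Ω)) (hδ : 0 < δ) {k n : ℤ}
    (hf : IsFull Ω δ k n) (hp : ¬ IsPerfect Ω δ k n) :
    ∃ v, IsCorner k n v ∧ meshPoint δ v ∈ frontier (triLinear ⁻¹' Ω) := by
  simp only [IsPerfect, not_and, not_forall] at hp
  obtain ⟨v, hv, hvΩ⟩ := hp hf
  rw [mem_triMeshVertices_iff_shear] at hvΩ
  exact ⟨v, hv, Mesh.mem_frontier_of_mem_closure hΩo
    (hf.closure_subset (meshPoint_mem_closure_ktri hδ hv)) hvΩ⟩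

/-- **Converse coordinate bounds.** A point with `re ∈ (δk', δ(k'+1))`, `im ∈ (δj', δ(j'+1))` and
`re + im ∈ (δ(k' + ⌈n'/2⌉), δ(k' + ⌈n'/2⌉ + 1))`, where `⌊n'/2⌋ = j'`, lies in the triangle `n'`
of column `k'`. [folklore] -/
theorem mem_ktri_of_coord_bounds {δ : ℝ} {k' n' : ℤ} {z : ℂ} (h1 : δ * k' < z.re)
    (h2 : z.re < δ * (k' + 1)) (h3 : δ * cBot n' < z.im) (h4 : z.im < δ * (cBot n' + 1))
    (h5 : δ * (k' + cTop n') < z.re + z.im) (h6 : z.re + z.im < δ * (k' + cTop n' + 1)) :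
    z ∈ ktri δ k' n' := by
  refine ⟨h1, h2, ?_, ?_⟩
  · unfold sideFn
    rw [cTop_eq] at h5 h6 ⊢
    push_cast at h5 h6 ⊢
    rcases emod_two_eq n' with h | h
    · have h0 : ((n' % 2 : ℤ) : ℝ) = 0 := by exact_mod_cast h
      rw [h0] at h5 h6 ⊢; linarith
    · have h0 : ((n' % 2 : ℤ) : ℝ) = 1 := by exact_mod_cast h
      rw [h0] at h5 h6 ⊢; linarith
  · unfold sideFn
    have h' : (((n' + 1) % 2 : ℤ) : ℝ) = 1 - ((n' % 2 : ℤ) : ℝ) := by exact_mod_cast emod_two_succ n'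
    rw [cTop_succ, h']
    rw [cTop_eq] at h5 h6
    push_cast at h5 h6 ⊢
    rcases emod_two_eq n' with h | h
    · have h0 : ((n' % 2 : ℤ) : ℝ) = 0 := by exact_mod_cast h
      rw [h0] at h5 h6 ⊢; linarith
    · have h0 : ((n' % 2 : ℤ) : ℝ) = 1 := by exact_mod_cast h
      rw [h0] at h5 h6 ⊢; linarith

/-- `⌊2j/2⌋ = j`, `⌈2j/2⌉ = j`. [folklore] -/
theorem cBot_two_mul (j : ℤ) : cBot (2 * j) = j ∧ cTop (2 * j) = j := by
  unfold cBot cTop; omega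

/-- `⌊(2j+1)/2⌋ = j`, `⌈(2j+1)/2⌉ = j + 1`. [folklore] -/
theorem cBot_two_mul_add_one (j : ℤ) : cBot (2 * j + 1) = j ∧ cTop (2 * j + 1) = j + 1 := by
  unfold cBot cTop; omega

/-- **Locating a point in a triangle at a given lattice point.** If `x` lies strictly inside the
mesh intervals `re ∈ (δk', δ(k'+1))`, `im ∈ (δj', δ(j'+1))` with `k' ∈ {v₀ - 1, v₀}`,
`j' ∈ {v₁ - 1, v₁}`, avoids the antidiagonal through `δv`, and is within `δ/4` of it in the sum
coordinate, then `x` lies in an open triangle having `v` as a corner. [folklore] -/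
theorem exists_ktri_isCorner_of_near {δ : ℝ} {v : Site 2} {x : ℂ} {k' j' : ℤ}
    (hk' : k' = v 0 - 1 ∨ k' = v 0) (hj' : j' = v 1 - 1 ∨ j' = v 1)
    (hre : x.re ∈ Ioo (δ * k') (δ * (k' + 1))) (him : x.im ∈ Ioo (δ * j') (δ * (j' + 1)))
    (hsum : |x.re + x.im - δ * (v 0 + v 1)| < δ / 4) (hne : x.re + x.im ≠ δ * (v 0 + v 1)) :
    ∃ n' : ℤ, x ∈ ktri δ k' n' ∧ IsCorner k' n' v := by
  obtain ⟨h1, h2⟩ := hre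
  obtain ⟨h3, h4⟩ := him
  rw [abs_lt] at hsum
  obtain ⟨hs1, hs2⟩ := hsum
  -- the sum lies on one side of `δ(k' + j' + 1)`
  rcases lt_trichotomy (x.re + x.im) (δ * (k' + j' + 1)) with hlt | heq | hgt
  · -- lower triangle `n' = 2j'`
    refine ⟨2 * j', mem_ktri_of_coord_bounds h1 h2 (by rw [(cBot_two_mul j').1]; exact h3)
      (by rw [(cBot_two_mul j').1]; exact h4) (by rw [(cBot_two_mul j').2]; linarith)
      (by rw [(cBot_two_mul j').2]; linarith), ?_⟩
    -- the corners are `(k', j')`, `(k'+1, j')`, `(k', j'+1)`; which one is `v`?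
    rcases hk' with rfl | rfl <;> rcases hj' with rfl | rfl
    · -- cell `(v₀-1, v₁-1)`: the sum would be `< δ(v₀ + v₁ - 1)`, too small
      exfalso; push_cast at hlt; linarith
    · -- cell `(v₀-1, v₁)`: `v = (k'+1, j')` is the right end of edge `n'`
      refine Or.inr (Or.inl (Mesh.site2_ext' (by simp) ?_))
      rw [xR_one, (cBot_two_mul _).1]
    · -- cell `(v₀, v₁-1)`: `v = (k', j'+1)` is the left end of edge `n'+1`
      refine Or.inr (Or.inr (Or.inl (Mesh.site2_ext' (by simp) ?_)))
      rw [xL_one, cTop_succ, (cBot_two_mul _).1]; ring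
    · -- cell `(v₀, v₁)`: `v = (k', j')` is the left end of edge `n'`
      refine Or.inl (Mesh.site2_ext' (by simp) ?_)
      rw [xL_one, (cBot_two_mul _).2]
  · -- on the antidiagonal `δ(k'+j'+1)`: excluded
    exfalso
    rcases hk' with rfl | rfl <;> rcases hj' with rfl | rfl
    · push_cast at heq; linarith
    · exact hne (by rw [heq]; push_cast; ring)
    · exact hne (by rw [heq]; push_cast; ring)
    · linarith
  · -- upper triangle `n' = 2j' + 1`
    refine ⟨2 * j' + 1, mem_ktri_of_coord_bounds h1 h2 (by rw [(cBot_two_mul_add_one j').1]; exact h3)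
      (by rw [(cBot_two_mul_add_one j').1]; exact h4)
      (by rw [(cBot_two_mul_add_one j').2]; push_cast; linarith)
      (by rw [(cBot_two_mul_add_one j').2]; push_cast; linarith), ?_⟩
    -- the corners are `(k', j'+1)`, `(k'+1, j')`, `(k'+1, j'+1)`
    rcases hk' with rfl | rfl <;> rcases hj' with rfl | rfl
    · -- cell `(v₀-1, v₁-1)`: `v = (k'+1, j'+1)` is the right end of edge `n'+1`
      refine Or.inr (Or.inr (Or.inr (Mesh.site2_ext' (by simp) ?_)))
      rw [xR_one, cBot_succ, (cBot_two_mul_add_one _).2]; ring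
    · -- cell `(v₀-1, v₁)`: `v = (k'+1, j')` is the right end of edge `n'`
      refine Or.inr (Or.inl (Mesh.site2_ext' (by simp) ?_))
      rw [xR_one, (cBot_two_mul_add_one _).1]
    · -- cell `(v₀, v₁-1)`: `v = (k', j'+1)` is the left end of edge `n'`
      refine Or.inl (Mesh.site2_ext' (by simp) ?_)
      rw [xL_one, (cBot_two_mul_add_one _).2]; ring
    · -- cell `(v₀, v₁)`: the sum would be `> δ(v₀ + v₁ + 1)`, too big
      exfalso; linarith

/-- **Exterior points next to a lattice point of the closure of the exterior.** If the mesh point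
`κ = δv` lies in the closure of the exterior `(Ω̄')ᶜ`, then some open triangle having `v` as a
corner contains an exterior point within `δ/2` of `κ` (`δ > 0`): move an exterior point near `κ`
off the three lattice lines through `κ`, inside a small exterior ball. [folklore] -/
theorem exists_exterior_ktri_near (hδ : 0 < δ) {v : Site 2}
    (hv : meshPoint δ v ∈ closure (closure (triLinear ⁻¹' Ω))ᶜ) :
    ∃ (k' n' : ℤ) (x : ℂ), IsCorner k' n' v ∧ x ∈ ktri δ k' n' ∧
      x ∈ (closure (triLinear ⁻¹' Ω))ᶜ ∧ dist x (meshPoint δ v) < δ / 2 := by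
  -- an exterior point `e` near `κ`, with a small ball in the exterior
  rw [Metric.mem_closure_iff] at hv
  obtain ⟨e, heE, hed⟩ := hv (δ / 16) (by positivity)
  have hEo : IsOpen (closure (triLinear ⁻¹' Ω))ᶜ := isClosed_closure.isOpen_compl
  obtain ⟨r, hr, hball⟩ := Metric.isOpen_iff.1 hEo e heE
  set ρ : ℝ := min (r / 4) (δ / 32) with hρ
  have hρpos : 0 < ρ := lt_min (by positivity) (by positivity)
  have hρr : ρ ≤ r / 4 := min_le_left _ _
  have hρδ : ρ ≤ δ / 32 := min_le_right _ _
  set κ := meshPoint δ v with hκ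
  -- step 1: move both coordinates away from those of `κ` by `ρ`
  obtain ⟨hxr1, hxr2⟩ := Mesh.abs_moveAway (t := e.re) (c := κ.re) hρpos
  obtain ⟨hxi1, hxi2⟩ := Mesh.abs_moveAway (t := e.im) (c := κ.im) hρpos
  set xr : ℝ := if κ.re ≤ e.re then e.re + ρ else e.re - ρ with hxr
  set xi : ℝ := if κ.im ≤ e.im then e.im + ρ else e.im - ρ with hxi
  -- step 2: if the sum coordinate is that of `κ`, nudge the real part by `ρ/2`
  set xr' : ℝ := if xr + xi = κ.re + κ.im then xr + ρ / 2 else xr with hxr'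
  set x : ℂ := ⟨xr', xi⟩ with hx
  have hxr'r : |xr' - xr| ≤ ρ / 2 := by
    rw [hxr']; split_ifs
    · rw [add_sub_cancel_left, abs_of_pos (by positivity)]
    · rw [sub_self, abs_zero]; positivity
  have hed' : dist e κ < δ / 16 := by rwa [dist_comm] at hed
  have hre_e : |e.re - κ.re| < δ / 16 :=
    (abs_re_le_norm (e - κ)).trans_lt (by rwa [← Complex.dist_eq])
  have him_e : |e.im - κ.im| < δ / 16 :=
    (abs_im_le_norm (e - κ)).trans_lt (by rwa [← Complex.dist_eq])
  -- `x` is in the exterior ball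
  have hxE : x ∈ (closure (triLinear ⁻¹' Ω))ᶜ := by
    refine hball (mem_ball.2 ?_)
    rw [Complex.dist_eq]
    refine (norm_le_abs_re_add_abs_im _).trans_lt ?_
    simp only [sub_re, sub_im]
    change |xr' - e.re| + |xi - e.im| < r
    have : |xr' - e.re| ≤ |xr' - xr| + |xr - e.re| := abs_sub_le _ _ _
    rw [hxr2] at this
    rw [hxi2]
    linarith
  -- the coordinates of `x` relative to `κ`: off the lines, and close
  have h1 : ρ / 2 ≤ |xr' - κ.re| ∧ |xr' - κ.re| < δ / 8 := by
    constructor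
    · rw [hxr']; split_ifs with hs
      · -- `xr' = xr + ρ/2`
        rw [hxr] at hxr1 ⊢
        split_ifs at hxr1 ⊢ with hle
        · rw [abs_of_nonneg (by linarith)]; linarith
        · push Not at hle
          rw [abs_of_nonpos (by linarith)] at hxr1
          rcases le_or_gt (e.re - ρ + ρ / 2 - κ.re) 0 with h | h
          · rw [abs_of_nonpos h]; linarith
          · rw [abs_of_pos h]; linarith
      · linarith
    · calc |xr' - κ.re| ≤ |xr' - xr| + |xr - κ.re| := abs_sub_le _ _ _
        _ ≤ ρ / 2 + (|xr - e.re| + |e.re - κ.re|) := by gcongr; exact abs_sub_le _ _ _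
        _ < δ / 8 := by rw [hxr2]; linarith
  have h2 : ρ ≤ |xi - κ.im| ∧ |xi - κ.im| < δ / 8 := by
    refine ⟨hxi1, ?_⟩
    calc |xi - κ.im| ≤ |xi - e.im| + |e.im - κ.im| := abs_sub_le _ _ _
      _ < δ / 8 := by rw [hxi2]; linarith
  have h3 : xr' + xi ≠ κ.re + κ.im := by
    rw [hxr']; split_ifs with hs
    · intro h; rw [← hs] at h; linarith
    · exact hs
  have hxr_ne : xr' ≠ κ.re := fun h => by
    rw [h, sub_self, abs_zero] at h1; linarith [h1.1]
  have hxi_ne : xi ≠ κ.im := fun h => by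
    rw [h, sub_self, abs_zero] at h2; linarith [h2.1]
  have hκre : κ.re = δ * v 0 := meshPoint_re δ v
  have hκim : κ.im = δ * v 1 := meshPoint_im δ v
  obtain ⟨k', hk', hk'mem⟩ := Mesh.exists_mem_Ioo_of_abs_lt (δ := δ) (n := v 0) (t := xr')
    (by rw [← hκre]; linarith [h1.2]) (by rwa [← hκre])
  obtain ⟨j', hj', hj'mem⟩ := Mesh.exists_mem_Ioo_of_abs_lt (δ := δ) (n := v 1) (t := xi)
    (by rw [← hκim]; linarith [h2.2]) (by rwa [← hκim])
  have hsum : |x.re + x.im - δ * (v 0 + v 1)| < δ / 4 := by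
    change |xr' + xi - δ * (v 0 + v 1)| < δ / 4
    have : xr' + xi - δ * (v 0 + v 1) = (xr' - κ.re) + (xi - κ.im) := by rw [hκre, hκim]; ring
    rw [this]
    refine (abs_add_le _ _).trans_lt ?_
    linarith [h1.2, h2.2]
  have hne : x.re + x.im ≠ δ * (v 0 + v 1) := by
    change xr' + xi ≠ δ * (v 0 + v 1)
    rwa [mul_add, ← hκre, ← hκim]
  obtain ⟨n', hxmem, hcorner⟩ := exists_ktri_isCorner_of_near hk' hj' hk'mem hj'mem hsum hne
  refine ⟨k', n', x, hcorner, hxmem, hxE, ?_⟩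
  rw [Complex.dist_eq]
  refine (norm_le_abs_re_add_abs_im _).trans_lt ?_
  simp only [sub_re, sub_im]
  change |xr' - κ.re| + |xi - κ.im| < δ / 2
  linarith [h1.2, h2.2]

/-- **Open segments from a corner into the triangle.** The open segment from a corner of a triangle
to a point of the (open, convex) triangle lies in the triangle. [folklore] -/
theorem openSegment_corner_subset_ktri (hδ : 0 < δ) {k n : ℤ} {v : Site 2} (hv : IsCorner k n v)
    {x : ℂ} (hx : x ∈ ktri δ k n) : openSegment ℝ (meshPoint δ v) x ⊆ ktri δ k n := by
  have h := (convex_ktri δ k n).openSegment_closure_interior_subset_interior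
    (meshPoint_mem_closure_ktri hδ hv) (by rwa [(isOpen_ktri δ k n).interior_eq])
  rwa [(isOpen_ktri δ k n).interior_eq] at h

/-- The open segment from a point of a triangle to a point of its closure lies in the triangle.
[folklore] -/
theorem openSegment_subset_ktri_of_mem_closure (k n : ℤ) {x z : ℂ} (hx : x ∈ ktri δ k n)
    (hz : z ∈ closure (ktri δ k n)) : openSegment ℝ x z ⊆ ktri δ k n := by
  have h := (convex_ktri δ k n).openSegment_interior_closure_subset_interior
    (by rwa [(isOpen_ktri δ k n).interior_eq]) hz
  rwa [(isOpen_ktri δ k n).interior_eq] at h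

/-! ### Book-keeping for the counting argument -/

/-- The ball of radius `δ/8` about the centre lies in the triangle. [folklore] -/
theorem ball_kcenter_subset_ktri {δ : ℝ} (hδ : 0 < δ) (k n : ℤ) :
    ball (kcenter δ k n) (δ / 8) ⊆ ktri δ k n := by
  intro z hz
  rw [mem_ball, Complex.dist_eq] at hz
  have hre := (abs_re_le_norm (z - kcenter δ k n)).trans_lt hz
  have him := (abs_im_le_norm (z - kcenter δ k n)).trans_lt hz
  rw [sub_re, kcenter_re, abs_lt] at hre
  rw [sub_im, kcenter_im, abs_lt] at him
  obtain ⟨hr0, hr1⟩ := emod_two_real_mem n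
  have hc1 := sideFn_kcenter δ k n
  have hc2 := sideFn_succ_kcenter δ k n
  -- write `z = c + (z - c)` and use the affine form of `sideFn`
  have key : ∀ m : ℤ, sideFn δ k m z = sideFn δ k m (kcenter δ k n) +
      ((z.im - (kcenter δ k n).im) + ((m % 2 : ℤ) : ℝ) * (z.re - (kcenter δ k n).re)) := by
    intro m; unfold sideFn; ring
  obtain ⟨hr0', hr1'⟩ := emod_two_real_mem (n + 1)
  refine ⟨by linarith, by linarith, ?_, ?_⟩
  · rw [key n, hc1, kcenter_re, kcenter_im]
    nlinarith [abs_nonneg (z.re - δ * (k + 1 / 2)), abs_lt.2 ⟨hre.1, hre.2⟩,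
      neg_abs_le (z.re - δ * (↑k + 1 / 2)), le_abs_self (z.re - δ * (↑k + 1 / 2))]
  · rw [key (n + 1), hc2, kcenter_re, kcenter_im]
    nlinarith [abs_nonneg (z.re - δ * (k + 1 / 2)), abs_lt.2 ⟨hre.1, hre.2⟩,
      neg_abs_le (z.re - δ * (↑k + 1 / 2)), le_abs_self (z.re - δ * (↑k + 1 / 2))]

/-- **Distinct triangles are disjoint.** [folklore] -/
theorem ktri_disjoint {δ : ℝ} (hδ : 0 < δ) {k n k' n' : ℤ} (h : (k, n) ≠ (k', n')) :
    Disjoint (ktri δ k n) (ktri δ k' n') := by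
  rw [Set.disjoint_left]
  intro z hz hz'
  obtain ⟨⟨h1, h2⟩, ⟨h3, h4⟩, h5, h6⟩ := coord_bounds_of_mem_ktri hz
  obtain ⟨⟨h1', h2'⟩, ⟨h3', h4'⟩, h5', h6'⟩ := coord_bounds_of_mem_ktri hz'
  have hk : k = k' := by
    have a1 : (k : ℝ) < k' + 1 := lt_of_mul_lt_mul_left (h1.trans h2') hδ.le
    have a2 : (k' : ℝ) < k + 1 := lt_of_mul_lt_mul_left (h1'.trans h2) hδ.le
    have : k < k' + 1 := by exact_mod_cast a1
    have : k' < k + 1 := by exact_mod_cast a2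
    omega
  have hb : cBot n = cBot n' := by
    have a1 : (cBot n : ℝ) < cBot n' + 1 := lt_of_mul_lt_mul_left (h3.trans h4') hδ.le
    have a2 : (cBot n' : ℝ) < cBot n + 1 := lt_of_mul_lt_mul_left (h3'.trans h4) hδ.le
    have : cBot n < cBot n' + 1 := by exact_mod_cast a1
    have : cBot n' < cBot n + 1 := by exact_mod_cast a2
    omega
  have ht : cTop n = cTop n' := by
    subst hk
    have a1 : (k : ℝ) + cTop n < k + cTop n' + 1 := lt_of_mul_lt_mul_left (h5.trans h6') hδ.le
    have a2 : (k : ℝ) + cTop n' < k + cTop n + 1 := lt_of_mul_lt_mul_left (h5'.trans h6) hδ.le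
    have : cTop n < cTop n' + 1 := by
      have : (cTop n : ℝ) < cTop n' + 1 := by linarith
      exact_mod_cast this
    have : cTop n' < cTop n + 1 := by
      have : (cTop n' : ℝ) < cTop n + 1 := by linarith
      exact_mod_cast this
    omega
  have hn : n = n' := by
    have e1 := two_mul_cBot_add n
    have e2 := two_mul_cBot_add n'
    have e3 := cTop_eq n
    have e4 := cTop_eq n'
    omega
  exact h (by rw [hk, hn])

/-- Points of a triangle are within `2δ` of each of its corners (`δ > 0`). [folklore] -/
theorem dist_corner_lt_of_mem_ktri {k n : ℤ} {z : ℂ} (hz : z ∈ ktri δ k n) {v : Site 2}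
    (hv : IsCorner k n v) : dist z (meshPoint δ v) < 2 * δ := by
  obtain ⟨⟨h1, h2⟩, ⟨h3, h4⟩, -⟩ := coord_bounds_of_mem_ktri hz
  obtain ⟨hr0, hr1⟩ := emod_two_real_mem n
  have hct : (cTop n : ℝ) = cBot n + ((n % 2 : ℤ) : ℝ) := by exact_mod_cast cTop_eq n
  -- coordinates of the corner
  have hv' : (v 0 = k ∨ v 0 = k + 1) ∧ (v 1 = cBot n ∨ v 1 = cBot n + 1) := by
    rcases hv with rfl | rfl | rfl | rfl
    · refine ⟨Or.inl rfl, ?_⟩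
      rw [xL_one, cTop_eq]; rcases emod_two_eq n with h | h <;> rw [h] <;> simp
    · exact ⟨Or.inr rfl, Or.inl rfl⟩
    · exact ⟨Or.inl rfl, Or.inr (xL_succ_one k n)⟩
    · refine ⟨Or.inr rfl, ?_⟩
      rw [xR_succ_one, cTop_eq]; rcases emod_two_eq n with h | h <;> rw [h] <;> simp
  rw [Complex.dist_eq]
  refine (norm_le_abs_re_add_abs_im _).trans_lt ?_
  rw [sub_re, sub_im, meshPoint_re, meshPoint_im]
  have hre : |z.re - δ * v 0| < δ := by
    rcases hv'.1 with h | h <;> rw [h] <;> push_cast <;> rw [abs_lt] <;> constructor <;> nlinarith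
  have him : |z.im - δ * v 1| < δ := by
    rcases hv'.2 with h | h <;> rw [h] <;> push_cast <;> rw [abs_lt] <;> constructor <;> nlinarith
  linarith

/-- **A full triangle with a corner near `Ω'ᶜ` lies in the inner collar**: if a corner is at
distance `< ε` from `Ω'ᶜ` then every point of the triangle is at distance `< ε + 2δ`. [folklore] -/
theorem infDist_lt_of_mem_ktri {k n : ℤ} {v : Site 2} (hv : IsCorner k n v) {ε : ℝ}
    (hκ : infDist (meshPoint δ v) (triLinear ⁻¹' Ω)ᶜ < ε) {z : ℂ} (hz : z ∈ ktri δ k n) :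
    infDist z (triLinear ⁻¹' Ω)ᶜ < ε + 2 * δ := by
  have h := infDist_le_infDist_add_dist (s := (triLinear ⁻¹' Ω)ᶜ) (x := z) (y := meshPoint δ v)
  have hd := dist_corner_lt_of_mem_ktri hz hv
  linarith

/-- **Far triangles are not full**: if `Ω' ⊆ closedBall 0 R` then a full triangle has
`δ |k + ½| ≤ R` and `δ |n/2 + ¼| ≤ R` (`δ > 0`). [folklore] -/
theorem abs_le_of_isFull (hδ : 0 < δ) {R : ℝ} (hR : triLinear ⁻¹' Ω ⊆ closedBall (0 : ℂ) R)
    {k n : ℤ} (h : IsFull Ω δ k n) :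
    δ * |(k : ℝ) + 1 / 2| ≤ R ∧ δ * |(n : ℝ) / 2 + 1 / 4| ≤ R := by
  have hc : kcenter δ k n ∈ closedBall (0 : ℂ) R := hR (h (kcenter_mem_ktri hδ k n))
  rw [mem_closedBall, dist_zero_right] at hc
  have hre := (abs_re_le_norm (kcenter δ k n)).trans hc
  have him := (abs_im_le_norm (kcenter δ k n)).trans hc
  rw [kcenter_re, abs_mul, abs_of_pos hδ] at hre
  rw [kcenter_im, abs_mul, abs_of_pos hδ] at him
  exact ⟨hre, him⟩

end

end Literature.Probability.LatticeModels.TriMesh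

namespace Literature.Probability.LatticeModels.TriMesh

open Set Complex Metric Literature.Topology.PlaneTopology

noncomputable section

variable {Ω : Set ℂ} {δ : ℝ}

/-! ### Points avoiding the mesh -/

/-- `z` *avoids the triangular mesh* of `Ω` at scale `δ` (in lattice coordinates): it is not the
mesh point of a mesh vertex, and it lies on no closed mesh edge joining two mesh vertices.
[folklore] -/
def AvoidsMesh (Ω : Set ℂ) (δ : ℝ) (z : ℂ) : Prop :=
  (∀ v ∈ triMeshVertices Ω δ, z ≠ meshPoint δ v) ∧
    ∀ a ∈ triMeshVertices Ω δ, ∀ b ∈ triMeshVertices Ω δ, (triMeshGraph Ω δ).Adj a b →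
      z ∉ segment ℝ (meshPoint δ a) (meshPoint δ b)

/-- Points off the lattice lines avoid the mesh. [folklore] -/
theorem avoidsMesh_of_not_mem_triLines {z : ℂ} (hz : z ∉ triLines δ) : AvoidsMesh Ω δ z := by
  refine ⟨fun v _ h => hz (h ▸ meshPoint_mem_triLines δ v), fun a _ b _ hab h => hz ?_⟩
  exact segment_meshPoint_subset_triLines δ (triMeshGraph_adj_iff_shear.1 hab).1 h

/-- Points of open triangles avoid the mesh (`δ > 0`). [folklore] -/
theorem avoidsMesh_of_mem_ktri (hδ : 0 < δ) {k n : ℤ} {z : ℂ} (hz : z ∈ ktri δ k n) :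
    AvoidsMesh Ω δ z :=
  avoidsMesh_of_not_mem_triLines (ktri_subset_compl_triLines hδ k n hz)

/-- The mesh point of a site that is *not* a mesh vertex avoids the mesh (`δ > 0`). [folklore] -/
theorem avoidsMesh_meshPoint_of_not_mem (hδ : 0 < δ) {v : Site 2} (hv : v ∉ triMeshVertices Ω δ) :
    AvoidsMesh Ω δ (meshPoint δ v) := by
  refine ⟨fun w hw h => hv ?_, fun a ha b hb hab h => ?_⟩
  · rwa [Mesh.meshPoint_injective hδ.ne' h]
  · rcases Mesh.eq_or_eq_of_meshPoint_mem_segment_tri hδ (triMeshGraph_adj_iff_shear.1 hab).1 h with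
      rfl | rfl
    · exact hv ha
    · exact hv hb

/-- Exterior points (of `Ω'`) avoid the mesh: mesh vertices lie in `Ω'` and closed mesh edges in
`Ω̄'`. [folklore] -/
theorem avoidsMesh_of_mem_exterior {z : ℂ} (hz : z ∈ (closure (triLinear ⁻¹' Ω))ᶜ) :
    AvoidsMesh Ω δ z := by
  refine ⟨fun v hv h => hz ?_, fun a _ b _ hab h => hz ((triMeshGraph_adj_iff_shear.1 hab).2 h)⟩
  rw [h]
  exact subset_closure (mem_triMeshVertices_iff_shear.1 hv)

/-! ### Access paths from a non-perfect triangle to the exterior -/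

/-- **Access path.** If the triangle `n` of column `k` is not perfect (for open `Ω'` with
`∂Ω' ⊆ closure (Ω̄')ᶜ`, `δ > 0`), there is an exterior point `x` and a path from the centre of the
triangle to `x`, all of whose points avoid the mesh and lie within `4δ` of the centre. (Not full:
the segment to an exterior point of the triangle. Full: the segment to a corner `κ ∈ ∂Ω'`, then
the segment from `κ` to an exterior point of an open triangle at `κ`.) [folklore] -/
theorem exists_accessPath (hΩo : IsOpen (triLinear ⁻¹' Ω))
    (hJE : frontier (triLinear ⁻¹' Ω) ⊆ closure (closure (triLinear ⁻¹' Ω))ᶜ) (hδ : 0 < δ)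
    {k n : ℤ} (h : ¬ IsPerfect Ω δ k n) :
    ∃ x ∈ (closure (triLinear ⁻¹' Ω))ᶜ, ∃ γ : Path (kcenter δ k n) x,
      (∀ t, AvoidsMesh Ω δ (γ t)) ∧ ∀ t, dist (γ t) (kcenter δ k n) < 4 * δ := by
  have hc := kcenter_mem_ktri hδ k n
  by_cases hf : IsFull Ω δ k n
  · -- full but not perfect: through a boundary corner `κ = meshPoint δ v`
    obtain ⟨v, hv, hκ⟩ := exists_corner_mem_frontier hΩo hδ hf h
    obtain ⟨k', n', x, hv', hxtri, hxE, hxd⟩ := exists_exterior_ktri_near hδ (hJE hκ)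
    have hvΩ : v ∉ triMeshVertices Ω δ := by
      intro hvΩ
      rw [hΩo.frontier_eq] at hκ
      exact hκ.2 (mem_triMeshVertices_iff_shear.1 hvΩ)
    set κ := meshPoint δ v with hκdef
    set γ : Path (kcenter δ k n) x := (Path.segment (kcenter δ k n) κ).trans (Path.segment κ x) with hγ
    have hrange : ∀ t, γ t ∈ ktri δ k n ∨ γ t = κ ∨ γ t ∈ ktri δ k' n' := by
      intro t
      have hmem : γ t ∈ segment ℝ (kcenter δ k n) κ ∪ segment ℝ κ x := by
        have := mem_range_self (f := γ) t
        rwa [hγ, Path.trans_range, Path.range_segment, Path.range_segment] at this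
      rcases hmem with hm | hm
      · rcases Mesh.eq_or_eq_or_mem_openSegment hm with h1 | h1 | h1
        · left; rw [h1]; exact hc
        · exact Or.inr (Or.inl h1)
        · exact Or.inl (openSegment_subset_ktri_of_mem_closure k n hc
            (meshPoint_mem_closure_ktri hδ hv) h1)
      · rcases Mesh.eq_or_eq_or_mem_openSegment hm with h1 | h1 | h1
        · exact Or.inr (Or.inl h1)
        · right; right; rw [h1]; exact hxtri
        · exact Or.inr (Or.inr (openSegment_corner_subset_ktri hδ hv' hxtri h1))
    have hκc : dist κ (kcenter δ k n) < 2 * δ := by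
      rw [dist_comm]; exact dist_corner_lt_of_mem_ktri hc hv
    refine ⟨x, hxE, γ, fun t => ?_, fun t => ?_⟩
    · rcases hrange t with h1 | h1 | h1
      · exact avoidsMesh_of_mem_ktri hδ h1
      · rw [h1]; exact avoidsMesh_meshPoint_of_not_mem hδ hvΩ
      · exact avoidsMesh_of_mem_ktri hδ h1
    · rcases hrange t with h1 | h1 | h1
      · linarith [dist_lt_of_mem_ktri h1 hc]
      · rw [h1]; linarith
      · have h2 : dist (γ t) κ < 2 * δ := dist_corner_lt_of_mem_ktri h1 hv'
        linarith [dist_triangle (γ t) κ (kcenter δ k n)]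
  · -- not full: straight to an exterior point of the triangle
    obtain ⟨x, hxtri, hxE⟩ := exists_mem_ktri_exterior_of_not_isFull hΩo hJE hf
    have hsub : ∀ t, Path.segment (kcenter δ k n) x t ∈ ktri δ k n := fun t => by
      have hmem : Path.segment (kcenter δ k n) x t ∈ segment ℝ (kcenter δ k n) x := by
        rw [← Path.range_segment]; exact mem_range_self t
      exact (convex_ktri δ k n).segment_subset hc hxtri hmem
    refine ⟨x, hxE, Path.segment (kcenter δ k n) x, fun t => avoidsMesh_of_mem_ktri hδ (hsub t),
      fun t => ?_⟩
    linarith [dist_lt_of_mem_ktri (hsub t) hc]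

/-! ### The spine of a column and its crossing defect relative to a crossing edge -/

/-- The side functional of the crossing edge `n` of column `k` at a point of the midline at height
`y`: `-(δ/2)(2y - δn)` — negative above the crossing height `δn/2`, positive below. [folklore] -/
theorem segSide_kcross (δ : ℝ) (k n : ℤ) (y : ℝ) :
    segSide (meshPoint δ (xL k n)) (meshPoint δ (xR k n)) ⟨δ * (k + 1 / 2), y⟩ =
      -(δ / 2) * (2 * y - δ * n) := by
  have h := two_mul_cBot_add_real n
  unfold segSide
  rw [Complex.mul_im, Complex.conj_re, Complex.conj_im, sub_re, sub_im, sub_re, sub_im,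
    meshPoint_re, meshPoint_im, meshPoint_re, meshPoint_im, xL_zero, xL_one, xR_zero, xR_one, cTop_eq]
  push_cast
  linear_combination (δ * δ / 2) * h

/-- The midpoint of the crossing edge `n` of column `k` lies on the open edge and on the spine
between the centres of the triangles `b` and `t` when `b < n ≤ t`. [folklore] -/
theorem midpoint_kcross_mem (δ : ℝ) (k : ℤ) {b t n : ℤ} (h1 : b < n) (h2 : n ≤ t) :
    (⟨δ * (k + 1 / 2), δ * n / 2⟩ : ℂ) ∈ segment ℝ (kcenter δ k b) (kcenter δ k t) ∧
      (⟨δ * (k + 1 / 2), δ * n / 2⟩ : ℂ) ∈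
        openSegment ℝ (meshPoint δ (xL k n)) (meshPoint δ (xR k n)) := by
  constructor
  · have hpos : (0 : ℝ) < t - b := by
      have : b < t := h1.trans_le h2
      exact_mod_cast sub_pos.2 this
    set θ : ℝ := ((n : ℝ) - b - 1 / 2) / (t - b) with hθ
    have hθ0 : 0 ≤ θ := div_nonneg (by
      have : (b : ℝ) + 1 ≤ n := by exact_mod_cast h1
      linarith) hpos.le
    have hθ1 : θ ≤ 1 := by
      rw [div_le_one hpos]
      have : (n : ℝ) ≤ t := by exact_mod_cast h2
      linarith
    refine ⟨1 - θ, θ, by linarith, hθ0, by ring, ?_⟩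
    apply Complex.ext
    · simp only [add_re, smul_re, kcenter_re, smul_eq_mul]; ring
    · simp only [add_im, smul_im, kcenter_im, smul_eq_mul]
      have hθ' : θ * ((t : ℝ) - b) = n - b - 1 / 2 := by rw [hθ]; field_simp
      linear_combination (δ / 2) * hθ'
  · have h := two_mul_cBot_add_real n
    refine ⟨1 / 2, 1 / 2, by norm_num, by norm_num, by norm_num, ?_⟩
    apply Complex.ext
    · simp only [add_re, smul_re, smul_eq_mul, meshPoint_re, xL_zero, xR_zero]; push_cast; ring
    · simp only [add_im, smul_im, smul_eq_mul, meshPoint_im, xL_one, xR_one, cTop_eq]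
      push_cast
      linear_combination (δ / 2) * h

/-- **The spine crosses each crossing edge of its window once, positively.** The crossing defect
of the vertical segment from the centre of triangle `b` to the centre of triangle `t` relative to
the crossing edge `n` of column `k`, `b < n ≤ t`, is `2πi` (`δ > 0`). [folklore] -/
theorem crossInc_spine_kcross (hδ : 0 < δ) (k : ℤ) {b t n : ℤ} (h1 : b < n) (h2 : n ≤ t) :
    (Path.segment (kcenter δ k b) (kcenter δ k t)).crossInc
      (meshPoint δ (xL k n)) (meshPoint δ (xR k n)) = 2 * Real.pi * I := by
  obtain ⟨hseg, hopen⟩ := midpoint_kcross_mem δ k h1 h2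
  have hb : (b : ℝ) + 1 ≤ n := by exact_mod_cast h1
  have ht : (n : ℝ) ≤ t := by exact_mod_cast h2
  refine Path.crossInc_segment_of_cross ?_ ?_ ⟨_, hseg, hopen⟩
  · have : kcenter δ k b = ⟨δ * (k + 1 / 2), δ * ((b : ℝ) / 2 + 1 / 4)⟩ := rfl
    rw [this, segSide_kcross]
    nlinarith [mul_pos hδ hδ]
  · have : kcenter δ k t = ⟨δ * (k + 1 / 2), δ * ((t : ℝ) / 2 + 1 / 4)⟩ := rfl
    rw [this, segSide_kcross]
    nlinarith [mul_pos hδ hδ]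

/-- Points of the spine: `re z = δ(k + ½)` and `im z` between the two centre heights. [folklore] -/
theorem re_eq_and_im_mem_of_mem_spine {k b t : ℤ} (hle : b ≤ t) (hδ : 0 ≤ δ) {z : ℂ}
    (hz : z ∈ segment ℝ (kcenter δ k b) (kcenter δ k t)) :
    z.re = δ * (k + 1 / 2) ∧ δ * ((b : ℝ) / 2 + 1 / 4) ≤ z.im ∧ z.im ≤ δ * ((t : ℝ) / 2 + 1 / 4) := by
  obtain ⟨a, c, ha, hc, hac, rfl⟩ := hz
  simp only [add_re, smul_re, kcenter_re, smul_eq_mul, add_im, smul_im, kcenter_im]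
  have hle' : (b : ℝ) ≤ t := by exact_mod_cast hle
  refine ⟨by rw [← add_mul, hac, one_mul], ?_, ?_⟩
  · have : δ * ((b : ℝ) / 2 + 1 / 4) = a * (δ * ((b : ℝ) / 2 + 1 / 4)) + c * (δ * ((b : ℝ) / 2 + 1 / 4)) := by
      rw [← add_mul, hac, one_mul]
    rw [this]
    nlinarith [mul_nonneg hc hδ]
  · have : δ * ((t : ℝ) / 2 + 1 / 4) = a * (δ * ((t : ℝ) / 2 + 1 / 4)) + c * (δ * ((t : ℝ) / 2 + 1 / 4)) := by
      rw [← add_mul, hac, one_mul]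
    rw [this]
    nlinarith [mul_nonneg ha hδ]

/-- Points of the spine are within half the index range (times `δ`) of its bottom centre.
[folklore] -/
theorem dist_le_of_mem_spine {k b t : ℤ} (hle : b ≤ t) (hδ : 0 ≤ δ) {z : ℂ}
    (hz : z ∈ segment ℝ (kcenter δ k b) (kcenter δ k t)) :
    dist z (kcenter δ k b) ≤ δ * (t - b) / 2 := by
  obtain ⟨hre, h1, h2⟩ := re_eq_and_im_mem_of_mem_spine hle hδ hz
  rw [Complex.dist_eq]
  refine (norm_le_abs_re_add_abs_im _).trans ?_
  rw [sub_re, sub_im, hre, kcenter_re, kcenter_im, sub_self, abs_zero, zero_add,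
    abs_of_nonneg (by linarith)]
  linarith

/-! ### Spine points on mesh edges are window crossing edges -/

/-- An integer `a₀` with `a₀ + β = k + ½` for some `β ∈ [0, 1]` equals `k`, and `β = ½`.
[folklore] -/
theorem int_eq_of_add_eq_half {a₀ k : ℤ} {β : ℝ} (hβ0 : 0 ≤ β) (hβ1 : β ≤ 1)
    (h : (a₀ : ℝ) + β = k + 1 / 2) : a₀ = k ∧ β = 1 / 2 := by
  have h1 : (a₀ : ℝ) < k + 1 := by linarith
  have h2 : (k : ℝ) < a₀ + 1 := by linarith
  have h1' : a₀ < k + 1 := by exact_mod_cast h1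
  have h2' : k < a₀ + 1 := by exact_mod_cast h2
  have ha : a₀ = k := by omega
  refine ⟨ha, ?_⟩
  rw [ha] at h; linarith

/-- From `δ(b/2 + ¼) ≤ δ m/2 ≤ δ(t/2 + ¼)` (integers `b, t, m`, `δ > 0`): `b < m ≤ t`. [folklore] -/
theorem lt_and_le_of_height_bounds {δ : ℝ} (hδ : 0 < δ) {b t m : ℤ}
    (h1 : δ * ((b : ℝ) / 2 + 1 / 4) ≤ δ * m / 2) (h2 : δ * m / 2 ≤ δ * ((t : ℝ) / 2 + 1 / 4)) :
    b < m ∧ m ≤ t := by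
  have h1' : (b : ℝ) / 2 + 1 / 4 ≤ m / 2 := by
    have := h1; rw [mul_div_assoc] at this; exact le_of_mul_le_mul_left this hδ
  have h2' : (m : ℝ) / 2 ≤ t / 2 + 1 / 4 := by
    have := h2; rw [mul_div_assoc] at this; exact le_of_mul_le_mul_left this hδ
  have a1 : (b : ℝ) < m := by linarith
  have a2 : (m : ℝ) < t + 1 := by linarith
  have a1' : b < m := by exact_mod_cast a1
  have a2' : m < t + 1 := by exact_mod_cast a2
  exact ⟨a1', by omega⟩

/-- **A spine point on a closed `𝕋`-edge lies on a window crossing edge.** If a point with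
`re z = δ(k + ½)` and `δ(b/2 + ¼) ≤ im z ≤ δ(t/2 + ¼)` lies on the closed lattice edge `[δa, δa']`
(`a ∼ a'` in `𝕋`), then that edge is the crossing edge `n` of column `k` for some `b < n ≤ t`.
[folklore] -/
theorem exists_eq_kcross_of_mem_segment {δ : ℝ} (hδ : 0 < δ) {k b t : ℤ} {a a' : Site 2}
    (haa' : triGraph.Adj a a') {z : ℂ} (hz : z ∈ segment ℝ (meshPoint δ a) (meshPoint δ a'))
    (hre : z.re = δ * (k + 1 / 2)) (him1 : δ * ((b : ℝ) / 2 + 1 / 4) ≤ z.im)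
    (him2 : z.im ≤ δ * ((t : ℝ) / 2 + 1 / 4)) :
    ∃ n, b < n ∧ n ≤ t ∧ s(a, a') = kcross k n := by
  obtain ⟨α, β, hα, hβ, hαβ, rfl⟩ := hz
  simp only [add_re, smul_re, meshPoint_re, smul_eq_mul, add_im, smul_im, meshPoint_im] at hre him1 him2
  -- the real parts: `α a₀ + β a'₀ = k + ½`
  have hre' : α * (a 0 : ℝ) + β * (a' 0 : ℝ) = k + 1 / 2 := by
    have : δ * (α * (a 0 : ℝ) + β * (a' 0 : ℝ)) = δ * (k + 1 / 2) := by rw [← hre]; ring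
    exact mul_left_cancel₀ hδ.ne' this
  rcases triGraph_adj_apply haa' with ⟨h0, h1⟩ | ⟨h0, -⟩ | ⟨h0, h1⟩ | ⟨h0, -⟩ | ⟨h0, h1⟩ | ⟨h0, h1⟩
  · -- horizontal, `a' = a + e₀`: the rung at height `a₁`
    have h0' : (a' 0 : ℝ) = a 0 + 1 := by exact_mod_cast h0
    have h1' : (a' 1 : ℝ) = a 1 := by exact_mod_cast h1
    rw [h0'] at hre'
    obtain ⟨ha0, -⟩ := int_eq_of_add_eq_half (a₀ := a 0) (k := k) hβ (by linarith)
      (by linear_combination hre' - (a 0 : ℝ) * hαβ)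
    rw [h1', ← add_mul, hαβ, one_mul] at him1 him2
    obtain ⟨hb, ht⟩ := lt_and_le_of_height_bounds hδ (b := b) (t := t) (m := 2 * a 1)
      (by push_cast; linarith) (by push_cast; linarith)
    refine ⟨2 * a 1, hb, ht, ?_⟩
    rw [kcross, Sym2.eq_iff]; left
    exact ⟨Mesh.site2_ext' (by rw [xL_zero, ha0]) (by simp only [xL_one, cTop]; omega),
      Mesh.site2_ext' (by rw [xR_zero]; omega) (by simp only [xR_one, cBot]; omega)⟩
  · -- vertical: the real part would be an integer multiple of `δ`
    exfalso
    have h0' : (a' 0 : ℝ) = a 0 := by exact_mod_cast h0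
    rw [h0', ← add_mul, hαβ, one_mul] at hre'
    exact Mesh.half_ne_mul_int hδ k (a 0) (by rw [hre'])
  · -- horizontal, `a = a' + e₀`
    have h0' : (a 0 : ℝ) = a' 0 + 1 := by exact_mod_cast h0
    have h1' : (a 1 : ℝ) = a' 1 := by exact_mod_cast h1
    rw [h0'] at hre'
    obtain ⟨ha0, -⟩ := int_eq_of_add_eq_half (a₀ := a' 0) (k := k) hα (by linarith)
      (by linear_combination hre' - (a' 0 : ℝ) * hαβ)
    rw [h1', ← add_mul, hαβ, one_mul] at him1 him2
    obtain ⟨hb, ht⟩ := lt_and_le_of_height_bounds hδ (b := b) (t := t) (m := 2 * a' 1)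
      (by push_cast; linarith) (by push_cast; linarith)
    refine ⟨2 * a' 1, hb, ht, ?_⟩
    rw [kcross, Sym2.eq_iff]; right
    exact ⟨Mesh.site2_ext' (by rw [xR_zero]; omega) (by simp only [xR_one, cBot]; omega),
      Mesh.site2_ext' (by rw [xL_zero, ha0]) (by simp only [xL_one, cTop]; omega)⟩
  · exfalso
    have h0' : (a' 0 : ℝ) = a 0 := by exact_mod_cast h0.symm
    rw [h0', ← add_mul, hαβ, one_mul] at hre'
    exact Mesh.half_ne_mul_int hδ k (a 0) (by rw [hre'])
  · -- antidiagonal, `a' = a + (1, -1)`: the edge `2a₁ - 1`, crossing height `δ(a₁ - ½)`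
    have h0' : (a' 0 : ℝ) = a 0 + 1 := by exact_mod_cast h0
    have h1' : (a' 1 : ℝ) = a 1 - 1 := by
      have : (a' 1 : ℝ) = ((a 1 - 1 : ℤ) : ℝ) := by exact_mod_cast h1
      push_cast at this; exact this
    rw [h0'] at hre'
    obtain ⟨ha0, hβ'⟩ := int_eq_of_add_eq_half (a₀ := a 0) (k := k) hβ (by linarith)
      (by linear_combination hre' - (a 0 : ℝ) * hαβ)
    rw [h1'] at him1 him2
    have hαv : α = 1 / 2 := by linarith
    rw [hαv, hβ'] at him1 him2
    obtain ⟨hb, ht⟩ := lt_and_le_of_height_bounds hδ (b := b) (t := t) (m := 2 * a 1 - 1)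
      (by push_cast; linarith) (by push_cast; linarith)
    refine ⟨2 * a 1 - 1, hb, ht, ?_⟩
    rw [kcross, Sym2.eq_iff]; left
    exact ⟨Mesh.site2_ext' (by rw [xL_zero, ha0]) (by simp only [xL_one, cTop]; omega),
      Mesh.site2_ext' (by rw [xR_zero]; omega) (by simp only [xR_one, cBot]; omega)⟩
  · -- antidiagonal, `a = a' + (1, -1)`
    have h0' : (a 0 : ℝ) = a' 0 + 1 := by exact_mod_cast h0
    have h1' : (a 1 : ℝ) = a' 1 - 1 := by
      have : (a 1 : ℝ) = ((a' 1 - 1 : ℤ) : ℝ) := by exact_mod_cast h1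
      push_cast at this; exact this
    rw [h0'] at hre'
    obtain ⟨ha0, hα'⟩ := int_eq_of_add_eq_half (a₀ := a' 0) (k := k) hα (by linarith)
      (by linear_combination hre' - (a' 0 : ℝ) * hαβ)
    rw [h1'] at him1 him2
    have hβv : β = 1 / 2 := by linarith
    rw [hα', hβv] at him1 him2
    obtain ⟨hb, ht⟩ := lt_and_le_of_height_bounds hδ (b := b) (t := t) (m := 2 * a' 1 - 1)
      (by push_cast; linarith) (by push_cast; linarith)
    refine ⟨2 * a' 1 - 1, hb, ht, ?_⟩
    rw [kcross, Sym2.eq_iff]; right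
    exact ⟨Mesh.site2_ext' (by rw [xR_zero]; omega) (by simp only [xR_one, cBot]; omega),
      Mesh.site2_ext' (by rw [xL_zero, ha0]) (by simp only [xL_one, cTop]; omega)⟩

end

end Literature.Probability.LatticeModels.TriMesh
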